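import Summits.BirchSwinnertonDyer.Rank1Residual.X11b.RouteR1IntFrame
import Summits.BirchSwinnertonDyer.Rank1Residual.X11b.BDPValueRigidity
import Summits.BirchSwinnertonDyer.Rank1Residual.X11b.CharacterSupply
import HarnessLib

/-!
# X11b, route R1 at `p ≥ 5` — THE VALUE AT `𝟙` DOES NOT SEE THE FRAME: on SEMISTABLE pairs the value
# conjunct (Cas18 Thm. 3.2) of the open input is supplied FROM PRINT at EVERY frame, so the open
# content in frame form is exactly "interpolation ∧ main-conjecture equality for ONE `L`" (H3∃⁻)

HONEST FRAMING (cell `b2b-bsdres`, run/shared/lean/b2b/bsd-rank1-residual/, verbatim in every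
file): the goal of the cell is to DELETE the COMBINATION-SHAPED residual classes of the
Birch–Swinnerton-Dyer formula for ALL analytic-rank `≤ 1` elliptic curves over `ℚ` — "full BSD
formula for every rank `≤ 1` curve in class `C`" assembled STRICTLY from published theorems — so
that the rank-`≤ 1` remainder becomes exactly the CONSTRUCTION-SHAPED classes, which are TYPED
(missing-input `Prop`s), NOT attempted. This is not "finishing BSD". Sub-cell
`b2b-bsdres-multr1-p1` (X11b, route R1, gen 25); a RESEARCH ROUTE; no claim beyond the stated
class; X11b stays CONSTRUCTION-SHAPED; nothing here changes a label; ONE `Prop`-valued SHAPE with a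
body (nothing asserted) and theorems; no named fact; no `sorry`; every result using the OPEN shape is
CONDITIONAL.

## Why this file

Route R1's open input in frame form (gen 22, `R1.IMCEqFrameOnTree`, H3∃) asks per datum for ONE
frame `(Ω_K, Ω_p, L)` with THREE conjuncts: Castella's interpolation property (Thm. 3.1), the value at
`𝟙` (Thm. 3.2) and the main-conjecture equality (erratum Thm. 1.1). On SEMISTABLE pairs the first
two are the registered PUBLISHED fact `thm32_exists_isBDPLFunction_valueAtOne` — but for ITS frame,
while a refereed main conjecture would be typed for the frame of ITS source. With the CHARACTER SUPPLY
now a theorem (`characterSupplyAt`, this gen, on multr1-p2's interpolation character) x11b3-p3's S27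
VALUE RIGIDITY ACROSS PERIODS (`constantCoeff_eq_of_isBDPLFunction_of_supply`: two frames of the same
`(ι, 𝔭, κ, γ, f)` — ANY periods — have the same constant term) holds outright, so the value at `𝟙`
transfers from the published frame to every frame:

* §1 **`constantCoeff_eq_of_isBDPLFunction`** — S27 with the supply DISCHARGED (every odd `p`,
  `K` imaginary quadratic, `κ` anticyclotomic with topological generator `γ`);
  **`R1.bdpValueAtOneOnTreeAt_of_isBDPLFunction`** — the H2-shape `R1.BDPValueAtOneOnTreeAt`
  passes from one frame to any other.
* §2 **`R1.IMCEqCoreFrameOnTree W p`** (H3∃⁻, OPEN shape, claim-tagged): per datum of route R1,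
  THERE IS a frame `(Ω_K ≠ 0, Ω_p ∈ R₀ˣ, L ∈ R₀⟦T⟧)` with the interpolation property AND the
  main-conjecture equality — NO value conjunct. `R1.imcEqCoreFrameOnTree_of_imcEqFrame`: H3∃ ⟹ H3∃⁻
  (weaker). **`R1.imcEqFrameOnTree_of_thm32_of_imcEqCoreFrame`**: on a SEMISTABLE pair,
  `h32 ∧ H3∃⁻ ⟹ H3∃` (the value conjunct comes from print by §1), hence H3∃♭ and route R1's record.
* §3 **`R1.bsdp_of_thm32_of_imcEqCoreFrame_record`** — `BSD(E,p)` on SEMISTABLE pairs of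
  `R1Population ∩ {r_an = 1}` from EIGHT PUBLISHED facts (the seven of gen 22 + Cas18 Thms. 3.1–3.2
  `h32`), the FIVE CITED cohomological facts, and H3∃⁻ — whose honest open content is erratum
  Thm. 1.1 for a frame `L` typed TOGETHER with its interpolation property only, i.e. the shape in
  which a main-conjecture paper states its theorem (⇐ [FW21, Thm. 4.41], PREPRINT).

CONDITIONAL on H3∃⁻ (open); deletes nothing; X11b stays CONSTRUCTION-SHAPED; no label change.

References: [Castella2018] Thms. 2.3, 3.1, 3.2, §5 (arXiv:1704.06608 pp. 5, 9, 12);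
[Castella2018Erratum] Thm. 1.1 (p. 1); [FouquetWan2021] Thm. 4.41; [CastellaHsieh2018] §3.3.
-/

noncomputable section

open scoped Classical Topology

open Filter WeierstrassCurve NumberField IsDedekindDomain Field PowerSeries
open Literature.NumberTheory.EllipticCurves Literature.NumberTheory.EllipticCurves.GreenbergSelmer
open Literature.NumberTheory.EllipticCurves.ModularForms
open Literature.NumberTheory.EllipticCurves.Rank1Residual
open Literature.NumberTheory.EllipticCurves.Rank1Residual.Typed
open Literature.NumberTheory.EllipticCurves.Castella2018
open Literature.NumberTheory.GaloisRepresentations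
open Literature.NumberTheory.GaloisCohomology
open Summit.BirchSwinnertonDyer.Rank1Residual.X11b.AcSelmer
open Summit.BirchSwinnertonDyer.Rank1Residual.X11b.Halves

namespace Summit.BirchSwinnertonDyer.Rank1Residual.X11b

/-! ### §1 Value rigidity across periods, unconditional; the H2-shape passes between frames -/

section ValueRigidity

variable {p : ℕ} [Fact p.Prime] {K : Type} [Field K] [NumberField K] {N : ℕ}
  {ι : PadicAlgCl p ≃+* ℂ} {𝔭 : HeightOneSpectrum (𝓞 K)} {κ : ZpExtension K p}
  {γ : Field.absoluteGaloisGroup K} {f : CuspForm (CongruenceSubgroup.Gamma0 N) 2}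
  {ΩK ΩK' : ℂ} {Ωp Ωp' : ℂ_[p]} {L L' : UnrSeries p}

/-- **S27 'V1RIG' WITHOUT A SUPPLY HYPOTHESIS — the value at the trivial character does not see the
periods.** At an odd prime `p`, over an imaginary quadratic `K`, for an anticyclotomic `κ` with
topological generator `γ`: two frames `IsBDPLFunction ι 𝔭 κ γ f Ω_K Ω_p L`,
`IsBDPLFunction ι 𝔭 κ γ f Ω_K' Ω_p' L'` with non-zero periods have `[T⁰]L' = [T⁰]L`. This is
x11b3-p3's `constantCoeff_eq_of_isBDPLFunction_of_supply` fed with the supply `characterSupplyAt`.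
[cite: Castella2018, Thm. 3.1–3.2 (arXiv:1704.06608 pp. 8–9) (interpolation shape; the rigidity statement is elementary p-adic analysis on R₀⟦T⟧)]
[cite: CastellaHsieh2018, §3.3, Def. 3.5 and Prop. 3.6] -/
theorem constantCoeff_eq_of_isBDPLFunction (hp2 : p ≠ 2) (hK : IsImaginaryQuadratic K)
    (hκ : κ.IsAnticyclotomic) (hγ : κ.IsTopGenerator γ) (hΩK : ΩK ≠ 0) (hΩK' : ΩK' ≠ 0)
    (hΩp : Ωp ≠ 0) (hΩp' : Ωp' ≠ 0) (hL : IsBDPLFunction ι 𝔭 κ γ f ΩK Ωp L)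
    (hL' : IsBDPLFunction ι 𝔭 κ γ f ΩK' Ωp' L') :
    PowerSeries.constantCoeff L' = PowerSeries.constantCoeff L := by
  obtain ⟨m, x₀, φ, φ', r, r', hm, hne, hlim, hunr, hinf, hav, hfac, hval, hunr', hinf', hav', hfac',
    hval'⟩ := characterSupplyAt hp2 K ι κ γ hK hκ hγ
  exact constantCoeff_eq_of_isBDPLFunction_of_supply K N ι 𝔭 κ γ f ΩK ΩK' Ωp Ωp' L L' m x₀ φ φ' r
    r' hm hne hlim hunr hinf hav hfac hval hunr' hinf' hav' hfac' hval' hΩK hΩK' hΩp hΩp' hL hL'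

variable {W : WeierstrassCurve ℚ} [W.IsElliptic] [W.IsGloballyMinimal] {e : K →+* ℚ_[p]}
  {P : (W.baseChange K).toAffine.Point} {a : ℤ}

/-- **The H2-shape passes between frames.** If one frame `L'` of `(ι, 𝔭, κ, γ, f)` has the Thm. 3.2
value shape `R1.BDPValueAtOneOnTreeAt W p e P L' a` (`L'(𝟙) = u·((1 − a p⁻¹) log_{ω_E} P)²`,
`u ∈ R₀ˣ`), then EVERY frame `L` of the same data (any non-zero periods) has it: both values at `𝟙`
are the constant terms (`UnrSeries.hasValueAt_zero`), which agree (`constantCoeff_eq_of_isBDPLFunction`).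
[cite: Castella2018, Thm. 3.2 (arXiv:1704.06608 p. 9) (shape only; nothing asserted)] -/
theorem R1.bdpValueAtOneOnTreeAt_of_isBDPLFunction (hp2 : p ≠ 2) (hK : IsImaginaryQuadratic K)
    (hκ : κ.IsAnticyclotomic) [hγ : Fact (κ.IsTopGenerator γ)] (hΩK : ΩK ≠ 0) (hΩK' : ΩK' ≠ 0)
    (hΩp : Ωp ≠ 0) (hΩp' : Ωp' ≠ 0) (hL : IsBDPLFunction ι 𝔭 κ γ f ΩK Ωp L)
    (hL' : IsBDPLFunction ι 𝔭 κ γ f ΩK' Ωp' L') (h2 : R1.BDPValueAtOneOnTreeAt W p e P L' a) :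
    R1.BDPValueAtOneOnTreeAt W p e P L a := by
  obtain ⟨u, hu⟩ := h2
  refine ⟨u, ?_⟩
  have hc : PowerSeries.constantCoeff L = PowerSeries.constantCoeff L' :=
    (constantCoeff_eq_of_isBDPLFunction hp2 hK hκ hγ.out hΩK hΩK' hΩp hΩp' hL hL').symm
  have hv := UnrSeries.eq_constantCoeff_of_hasValueAt_zero hu
  have h0 := UnrSeries.hasValueAt_zero L
  rw [hc, ← hv] at h0
  exact h0

end ValueRigidity

/-! ### §2 The open input without the value conjunct (H3∃⁻) -/

section Shape

variable (W : WeierstrassCurve ℚ) [W.IsElliptic] [W.IsGloballyMinimal] (p : ℕ) [Fact p.Prime]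

/-- **H3∃⁻ — route R1's open input in frame form WITHOUT THE VALUE CONJUNCT (OPEN shape).** At every
datum of route R1 (exactly the binders of `R1.IMCEqFrameOnTree`: the A′-hypotheses, `r_an = 1`, a
non-split multiplicative `q ≠ p` with `E[p]` ramified, an erratum field `K` for `q` with [Cas20, §2.5]'s
standing hypotheses at the tame level, a parametrisation datum `Dt` at level `N_E` with `p ∤ c`, a
Heegner datum `H`, a point `P` of infinite order reading the Heegner point through `w₀`, every
anticyclotomic `(κ, γ)`, every `ι'` and every `e : K → ℚ_p` inducing `𝔭_{ι'}`): THERE EXISTS a frame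
`(Ω_K ≠ 0, Ω_p ∈ R₀ˣ, L ∈ R₀⟦T⟧)` with Castella's interpolation property
`IsBDPLFunction ι' 𝔭_{ι'} κ γ f Ω_K Ω_p L` [Cas18 Thm. 3.1] AND the main-conjecture equality
`Ch_Λ(X_ac^∅(E[p^∞]))·R₀⟦T⟧ = (L)` [erratum Thm. 1.1, `R1.IMCEqOnTreeAt`] — the ∃∧-transcription of
"an `L` characterised by its interpolation property satisfies the main conjecture", the shape in which
a main-conjecture paper states its theorem. A predicate on `(W, p)`; NEVER a theorem in this cell;
every result using it is CONDITIONAL. [claim: Castella2018Erratum, status: under-review]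
[cite: Castella2018, Thm. 3.1 and display (3.2) (arXiv:1704.06608 p. 9) (shape only; nothing asserted)] -/
def R1.IMCEqCoreFrameOnTree : Prop :=
  ∀ [NeZero (W.conductorNorm ℤ)] (q : ℕ) [Fact q.Prime] (K : Type) [Field K] [NumberField K]
    (Dt : ModularParametrizationData W (W.conductorNorm ℤ))
    (H : HeegnerDatum (W.conductorNorm ℤ) (NumberField.discr K)) (w₀ : InfinitePlace K)
    (P : (W.baseChange K).toAffine.Point), ErratumHypotheses W p → W.analyticRank = 1 →
    q ≠ p → Mult W q → ¬ W.HasSplitMultiplicativeReductionAtPrime q →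
    ¬ p ∣ padicValInt q W.minimalDiscriminantInt → IsErratumField W K q →
    Cas20Standing K p (W.conductorNorm ℤ / p) →
    WeierstrassCurve.Affine.Point.map w₀.embedding.toRatAlgHom P = heegnerPointComplex Dt H →
    ¬ (p : ℤ) ∣ Dt.c → ¬ IsOfFinAddOrder P →
    ∀ (κ : ZpExtension K p), κ.IsAnticyclotomic →
      ∀ (γ : Field.absoluteGaloisGroup K) [Fact (κ.IsTopGenerator γ)] (ι' : PadicAlgCl p ≃+* ℂ)
        (e : K →+* ℚ_[p]),
        (∀ k : 𝓞 K, k ∈ (primeOfEmbeddingDatum p ι' w₀.embedding).asIdeal ↔ ‖e (k : K)‖ < 1) →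
        ∃ (ΩK : ℂ) (Ωp : (unrIntegers p)ˣ) (L : UnrSeries p), ΩK ≠ 0 ∧
          IsBDPLFunction ι' (primeOfEmbeddingDatum p ι' w₀.embedding) κ γ Dt.f ΩK
            ((Ωp : unrIntegers p) : ℂ_[p]) L ∧
          R1.IMCEqOnTreeAt W p κ (primeOfEmbeddingDatum p ι' w₀.embedding) γ L

end Shape

section FromFrame

variable {W : WeierstrassCurve ℚ} [W.IsElliptic] [W.IsGloballyMinimal] {p : ℕ} [Fact p.Prime]

/-- **H3∃ ⟹ H3∃⁻** (forget the value conjunct): the new shape is WEAKER than gen 22's.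
CONDITIONAL on H3∃ (open). [cite: Castella2018, Thm. 3.1 (arXiv:1704.06608 p. 9)]
[cite: Castella2018Erratum, Thm. 1.1 (p. 1)] -/
theorem R1.imcEqCoreFrameOnTree_of_imcEqFrame (h3 : R1.IMCEqFrameOnTree W p) :
    R1.IMCEqCoreFrameOnTree W p := by
  intro _ q _ K _ _ Dt H w₀ P hE hr hqp hmq hns hvq hK hCas hP hc hinf κ hκ γ _ ι' e he
  obtain ⟨ΩK, Ωp, L, hΩ, hL, -, h3At⟩ :=
    h3 q K Dt H w₀ P hE hr hqp hmq hns hvq hK hCas hP hc hinf κ hκ γ ι' e he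
  exact ⟨ΩK, Ωp, L, hΩ, hL, h3At⟩

/-- **On a SEMISTABLE pair, `h32 ∧ H3∃⁻ ⟹ H3∃`: the value conjunct comes from print at ANY frame.**
At a datum, H3∃⁻ gives a frame `(Ω_K, Ω_p, L)` with interpolation ∧ main-conjecture equality; the
published fact (Cas18 Thms. 3.1–3.2, `R1.exists_frame_bdpValueAtOneOnTreeAt_of_thm32`) gives a frame
`(Ω_K', Ω_p', L')` of the SAME `(ι', 𝔭_{ι'}, κ, γ, f)` with the value at `𝟙`; by value rigidity across
periods (`R1.bdpValueAtOneOnTreeAt_of_isBDPLFunction`; `K` is imaginary quadratic as an erratum field,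
`p ≥ 5` is odd) the value shape holds for `L` too. CONDITIONAL on the published fact `h32` and on
H3∃⁻ (open). [cite: Castella2018, Thm. 3.1, display (3.2) and Thm. 3.2 (arXiv:1704.06608 p. 9)]
[cite: Castella2018Erratum, Thm. 1.1 (p. 1)] -/
theorem R1.imcEqFrameOnTree_of_thm32_of_imcEqCoreFrame
    (h32 : thm32_exists_isBDPLFunction_valueAtOne) (hss : Semistable W)
    (h3 : R1.IMCEqCoreFrameOnTree W p) : R1.IMCEqFrameOnTree W p := by
  intro _ q _ K _ _ Dt H w₀ P hE hr hqp hmq hns hvq hK hCas hP hc hinf κ hκ γ _ ι' e he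
  obtain ⟨ΩK, Ωp, L, hΩ, hL, h3At⟩ :=
    h3 q K Dt H w₀ P hE hr hqp hmq hns hvq hK hCas hP hc hinf κ hκ γ ι' e he
  obtain ⟨ΩK', Ωp', L', hΩ', hL', h2'⟩ :=
    R1.exists_frame_bdpValueAtOneOnTreeAt_of_thm32 h32 ι' Dt H hE hss hqp hK hc w₀ hP κ hκ γ he
  have hp2 : p ≠ 2 := hE.two_ne
  have hΩp : ((Ωp : unrIntegers p) : ℂ_[p]) ≠ 0 := by
    rw [Ne, ZeroMemClass.coe_eq_zero]
    exact Units.ne_zero Ωp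
  have hΩp' : ((Ωp' : unrIntegers p) : ℂ_[p]) ≠ 0 := by
    rw [Ne, ZeroMemClass.coe_eq_zero]
    exact Units.ne_zero Ωp'
  exact ⟨ΩK, Ωp, L, hΩ, hL,
    R1.bdpValueAtOneOnTreeAt_of_isBDPLFunction hp2 hK.1 hκ hΩ hΩ' hΩp hΩp' hL hL' h2', h3At⟩

/-- **On a SEMISTABLE pair, `h32 ∧ H3∃⁻ ⟹ H3∃♭`** (through gen 23's `R1.imcEqIntFrameOnTree_of_imcEqFrame`).
CONDITIONAL on `h32` (published) and H3∃⁻ (open). [cite: Castella2018, Thm. 3.1 and Thm. 3.2 (arXiv:1704.06608 p. 9)]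
[cite: Castella2018Erratum, Thm. 1.1 (p. 1)] -/
theorem R1.imcEqIntFrameOnTree_of_thm32_of_imcEqCoreFrame
    (h32 : thm32_exists_isBDPLFunction_valueAtOne) (hss : Semistable W)
    (h3 : R1.IMCEqCoreFrameOnTree W p) : R1.IMCEqIntFrameOnTree W p :=
  R1.imcEqIntFrameOnTree_of_imcEqFrame (R1.imcEqFrameOnTree_of_thm32_of_imcEqCoreFrame h32 hss h3)

end FromFrame

/-! ### §3 The record on semistable pairs from H3∃⁻ -/

section Record

variable {W : WeierstrassCurve ℚ} [W.IsElliptic] [W.IsGloballyMinimal] {p : ℕ} [Fact p.Prime]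

/-- **Route R1 — THE RECORD ON SEMISTABLE PAIRS FROM H3∃⁻ (gen 25): `p ≥ 5`, 8 PUBLISHED + 5 CITED +
ONE OPEN input carrying NO value conjunct.** For every SEMISTABLE globally minimal elliptic `W/ℚ` and
prime `p` on `R1Population` with `ord_{s=1} L(E,s) = 1`: `BSD(E,p)`, from the EIGHT PUBLISHED named
facts `hGZ` (Gross–Zagier 1986 I.7.3), `hGZK`, `hSk` (Skinner 2016 Thm. C), `hmod`, `hCST`
(Cai–Shu–Tian 2014 Thm. 1.1), `hFH` (Friedberg–Hoffstein 1995 Thm. B), `hMaz` (Mazur 1978 Cor. 4.1),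
`h32` (Cas18 Thms. 3.1–3.2), the FIVE CITED cohomological facts `hPT hPT2 hEP hcd hBr`, and the ONE
OPEN input `h3 : R1.IMCEqCoreFrameOnTree W p` — per datum a frame `L ∈ R₀⟦T⟧` with the interpolation
property and the main-conjecture equality, i.e. erratum Thm. 1.1 typed together with Thm. 3.1's
characterisation of `L_p(f)` and NOTHING ELSE (⇐ [FW21, Thm. 4.41], PREPRINT). The value at `𝟙` is no
longer part of the open shape: it is supplied from `h32` at every frame by value rigidity (§1).
CONDITIONAL; deletes nothing; X11b stays CONSTRUCTION-SHAPED; no label change.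
[cite: Castella2018, §5 (arXiv:1704.06608 p. 12)] [cite: Castella2018Erratum, Thm. 1.1, Thm. A′ (p. 1)] -/
theorem R1.bsdp_of_thm32_of_imcEqCoreFrame_record
    (hGZ : GrossZagier1986_thm_I_7_3) (hGZK : rank_eq_analyticRank_of_analyticRank_le_one)
    (hSk : Skinner2016.thmC_padicValRat_bsd_rank_zero) (hmod : exists_isNewformOf)
    (hCST : CaiShuTian2014.thm11_trivialChar)
    (hFH : friedbergHoffstein_exists_twist_ne_zero_ramifiedAt)
    (hMaz : mazur_not_dvd_maninConstant_of_odd) (h32 : thm32_exists_isBDPLFunction_valueAtOne)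
    (hPT : ∀ (K : Type) [Field K] [NumberField K], poitouTate_selmerStructure_duality K)
    (hPT2 : ∀ (K : Type) [Field K] [NumberField K], poitouTate_sha_tateDual K)
    (hEP : ∀ (K : Type) [Field K] [NumberField K] (v : HeightOneSpectrum (𝓞 K)),
      localEulerPoincareCharacteristic (v.adicCompletion K))
    (hcd : fieldCdLE_two_of_numberField)
    (hBr : ∀ (K : Type) [Field K] [NumberField K] (p : ℕ) [Fact p.Prime],
      ZpExtension.decomp_not_le_kerSubgroup_of_isAnticyclotomic K p)
    (hss : Semistable W) (h3 : R1.IMCEqCoreFrameOnTree W p) (hW : R1Population W p)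
    (hr : W.analyticRank = 1) : BSDp W p :=
  R1.bsdp_of_imcEqFrame_record hGZ hGZK hSk hmod hCST hFH hMaz hPT hPT2 hEP hcd hBr
    (R1.imcEqFrameOnTree_of_thm32_of_imcEqCoreFrame h32 hss h3) hW hr

/-- **Both sides of gen 19's tightness under `h32 ∧ H3∃⁻` on SEMISTABLE pairs**: the open input
`R1OpenInputOnTreeAt W p` AND `BSDp W p`. CONDITIONAL on H3∃⁻ (open).
[cite: Castella2018, §5 (arXiv:1704.06608 p. 12)] [cite: Castella2018Erratum, Thm. 1.1 (p. 1)] -/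
theorem R1.openInput_and_bsdp_of_thm32_of_imcEqCoreFrame_record
    (hGZ : GrossZagier1986_thm_I_7_3) (hGZK : rank_eq_analyticRank_of_analyticRank_le_one)
    (hSk : Skinner2016.thmC_padicValRat_bsd_rank_zero) (hmod : exists_isNewformOf)
    (hCST : CaiShuTian2014.thm11_trivialChar)
    (hFH : friedbergHoffstein_exists_twist_ne_zero_ramifiedAt)
    (hMaz : mazur_not_dvd_maninConstant_of_odd) (h32 : thm32_exists_isBDPLFunction_valueAtOne)
    (hPT : ∀ (K : Type) [Field K] [NumberField K], poitouTate_selmerStructure_duality K)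
    (hPT2 : ∀ (K : Type) [Field K] [NumberField K], poitouTate_sha_tateDual K)
    (hEP : ∀ (K : Type) [Field K] [NumberField K] (v : HeightOneSpectrum (𝓞 K)),
      localEulerPoincareCharacteristic (v.adicCompletion K))
    (hcd : fieldCdLE_two_of_numberField)
    (hBr : ∀ (K : Type) [Field K] [NumberField K] (p : ℕ) [Fact p.Prime],
      ZpExtension.decomp_not_le_kerSubgroup_of_isAnticyclotomic K p)
    (hss : Semistable W) (h3 : R1.IMCEqCoreFrameOnTree W p) (hW : R1Population W p)
    (hr : W.analyticRank = 1) : R1OpenInputOnTreeAt W p ∧ BSDp W p :=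
  R1.openInput_and_bsdp_of_imcEqFrame_record hGZ hGZK hSk hmod hCST hFH hMaz hPT hPT2 hEP hcd hBr
    (R1.imcEqFrameOnTree_of_thm32_of_imcEqCoreFrame h32 hss h3) hW hr

end Record

end Summit.BirchSwinnertonDyer.Rank1Residual.X11b

end
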